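import Mathlib
import Summits.ResolutionOfSingularities.ResolutionOfSingularities.Theorems.WildQuotientsWildQuotientResolutionPthConeDefs
import Summits.ResolutionOfSingularities.ResolutionOfSingularities.Theorems.WildQuotientsWildQuotientResolutionJordanThreeOneBlowup
import Summits.ResolutionOfSingularities.ResolutionOfSingularities.Theorems.WildQuotientsWildQuotientResolutionToricChartLemmas
import Summits.ResolutionOfSingularities.ResolutionOfSingularities.Theorems.WildQuotientsWildQuotientResolutionPthConeVeroneseChart

/-!
# ONE blow-up of the Veronese vertex resolves `(1/p)(1,…,1) × 𝔸^c`, for EVERY `p ≥ 2`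
(crux stmt-ResolutionOfSingularities-15640 `WildQuotients.WildQuotientResolution`, line `Sketch`;
chain w45c POST-V5 S2-P2 = `ConductorOneCore p n` of bricks, stage (ii) of res-L1-w45c-plan-1's
RULING 2026-08-27T16:07:22Z (B) / 16:20:20Z (2): the residual points of the conductor-one core of
Veronese type `(a,0)` (the point `[1:…:1]` of the exceptional divisor, idea-2 card
`conductor-one-kummer-core` (3)) are the cones `(1/p)(1^a) × 𝔸^c`, `μ_p` infinitesimal; the brick is
UNIFORM IN `p` — no certificate. [OURS · L1 W4.5c] — NOT a statement of any manuscript; replaces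
the role of no printed item. Owner res-L1-w45c-stub-4 (gen 4).)

Mould = res-L1-w45c-stub-2's T3 (`ThirdCone.isRegularRing_chartRing_cube`, `ThirdCone.blowup_regular`,
…ThirdConeChartCube / …ThirdConeBlowup) with `3 ↦ p` and exponent shift `d_s ∈ {0,1}`:
* `PthCone.basicOpen_le_of_pow_eq_mul` — `f^q = g·ρ ⇒ D₊(f) ≤ D₊(g)` (generic);
* `PthCone.reesT_vertex_pow_eq` — `(x^v t)^p = (x_z^p t) · t^{p−1} ∏_s (x_s^p)^{v_s − δ_{sz}}` in the
  Rees algebra (`ToricChart.prod_pow_mem_pow`);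
* the chart `D₊(x_z^p t)` is an affine space: `PthCone.isRegularRing_chartRing_purePow`
  (`…PthConeVeroneseChart`);
* `PthCone.isRegular_affineBlowup_veronese`, `PthCone.blowup_regular_veronese (hp : 1 < p)
  (hw : ∀ i, w i = 0 ∨ w i = 1) (h : ∃ i, w i = 1)` — regular, integral, proper, birational.
No notation (plan-1 §6 (30)).
-/

set_option linter.dupNamespace false

noncomputable section

open MvPolynomial IsLocalization AlgebraicGeometry CategoryTheory
open Literature.AlgebraicGeometry.Resolution

namespace Summit.ResolutionOfSingularities.ResolutionOfSingularities.Theorems.WildQuotientResolution.PthCone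

universe u


variable (k : Type) [Field k] (n p : ℕ) (w : Fin n → ZMod p)

/-! ## The blow-up of the Veronese vertex -/

/-- **A power relation puts a chart inside another**: if `f ^ q = g · ρ` (`0 < q`) in a graded ring then
`D₊(f) ≤ D₊(g)`. [folklore] -/
theorem basicOpen_le_of_pow_eq_mul {A σ : Type*} [CommRing A] [SetLike σ A] [AddSubgroupClass σ A]
    (𝒜 : ℕ → σ) [GradedRing 𝒜] (f g ρ : A) {q : ℕ} (hq : 0 < q) (h : f ^ q = g * ρ) :
    Proj.basicOpen 𝒜 f ≤ Proj.basicOpen 𝒜 g := by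
  rw [← Proj.basicOpen_pow 𝒜 f q hq, h, Proj.basicOpen_mul]
  exact inf_le_left

/-- `x_s^p` lies in the cone for every `s` (`p · w_s = 0` in `ZMod p`). [OURS · L1 W4.5c] -/
theorem monomial_single_p_mem_cone (s : Fin n) :
    (monomial (Finsupp.single s p) (1 : k) : MvPolynomial (Fin n) k) ∈ cone k n p w := by
  refine monomial_mem_cone k n p w ?_ 1
  rw [Finsupp.weight_apply, Finsupp.sum_single_index (zero_smul ℕ (w s)), nsmul_eq_mul,
    ZMod.natCast_self, zero_mul]

/-- **Power identity in the Rees algebra**: for a vertex index `v` and a weight-`1` variable `z` with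
`v_z ≥ 1`, `(x^v t)^p = (x_z^p t) · ρ` with `ρ = t^{p−1} ∏_s (x_s^p)^{v_s − δ_{sz}}`. [OURS · L1 W4.5c] -/
theorem reesT_vertex_pow_eq (hp : 0 < p) (v : VIdx n p w) (z : Fin n) (hz : w z = 1)
    (hvz : 0 < (v.1 z : ℕ)) :
    ∃ ρ : reesAlgebra (Ideal.span (Set.range (vertexFamily k n p w))),
      reesT (vertexFamily k n p w (Fintype.equivFin (VIdx n p w) v))
          (Ideal.mem_span_range_self (f := vertexFamily k n p w)
            (x := Fintype.equivFin (VIdx n p w) v)) ^ p =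
        reesT (vertexFamily k n p w (Fintype.equivFin (VIdx n p w) (pureIdx n p w z hz)))
          (Ideal.mem_span_range_self (f := vertexFamily k n p w)
            (x := Fintype.equivFin (VIdx n p w) (pureIdx n p w z hz))) * ρ := by
  classical
  -- the `p`-th powers of the variables as cone elements, and the exponents `e_s = v_s − δ_{sz}`
  let xp : Fin n → cone k n p w := fun s => ⟨monomial (Finsupp.single s p) 1, monomial_single_p_mem_cone k n p w s⟩
  let F : Finset (Fin n) := Finset.univ.filter fun s => w s = 1
  let e : Fin n → ℕ := fun s => (v.1 s : ℕ) - if s = z then 1 else 0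
  have hxpI : ∀ s ∈ F, xp s ∈ Ideal.span (Set.range (vertexFamily k n p w)) := by
    intro s hs
    have hs1 : w s = 1 := (Finset.mem_filter.mp hs).2
    have hxs : xp s = vertexGen k n p w (pureIdx n p w s hs1) :=
      Subtype.ext (by rw [coe_vertexGen, vertexExp_pureIdx])
    rw [hxs, ← vertexFamily_equivFin]
    exact Ideal.subset_span ⟨_, rfl⟩
  -- `∑_{s ∈ F} e_s = p − 1`
  have hvsum : ∑ s ∈ F, (v.1 s : ℕ) = p := by
    have h := v.2.1
    rw [← Finset.sum_filter_add_sum_filter_not Finset.univ (fun s => w s = 1),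
      Finset.sum_eq_zero (s := Finset.univ.filter fun s => ¬ w s = 1) (fun i hi => by
        rw [v.2.2 i (Finset.mem_filter.mp hi).2]; rfl), add_zero] at h
    exact h
  have hzF : z ∈ F := Finset.mem_filter.mpr ⟨Finset.mem_univ _, hz⟩
  have hez : e z = (v.1 z : ℕ) - 1 := by
    show (v.1 z : ℕ) - (if z = z then 1 else 0) = _
    rw [if_pos rfl]
  have hes : ∀ s, s ≠ z → e s = (v.1 s : ℕ) := fun s hs => by
    show (v.1 s : ℕ) - (if s = z then 1 else 0) = _
    rw [if_neg hs, Nat.sub_zero]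
  have hesum : ∑ s ∈ F, e s = p - 1 := by
    have h1 := Finset.add_sum_erase F e hzF
    have h2 := Finset.add_sum_erase F (fun s => (v.1 s : ℕ)) hzF
    have hrest : ∑ s ∈ F.erase z, e s = ∑ s ∈ F.erase z, (v.1 s : ℕ) :=
      Finset.sum_congr rfl fun s hs => hes s (Finset.ne_of_mem_erase hs)
    omega
  -- `r = ∏ (x_s^p)^{e_s} ∈ I^{p-1}`
  have hr : ∏ s ∈ F, xp s ^ e s ∈ Ideal.span (Set.range (vertexFamily k n p w)) ^ (p - 1) := by
    rw [← hesum]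
    exact ToricChart.prod_pow_mem_pow _ F xp hxpI e
  refine ⟨⟨Polynomial.monomial (p - 1) (∏ s ∈ F, xp s ^ e s), reesAlgebra.monomial_mem.mpr hr⟩,
    Subtype.ext ?_⟩
  rw [Subalgebra.coe_pow, Subalgebra.coe_mul, coe_reesT, coe_reesT, Polynomial.monomial_pow,
    Polynomial.monomial_mul_monomial, show 1 * p = 1 + (p - 1) by omega]
  congr 1
  -- the identity `(x^v)^p = x_z^p · ∏ (x_s^p)^{e_s}` in the cone
  rw [vertexFamily_equivFin, vertexFamily_equivFin]
  apply Subtype.ext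
  rw [Subalgebra.coe_pow, Subalgebra.coe_mul, SubmonoidClass.coe_finsetProd, coe_vertexGen,
    coe_vertexGen, vertexExp_pureIdx, monomial_pow, one_pow]
  have hfac : ∀ s, ((xp s ^ e s : cone k n p w) : MvPolynomial (Fin n) k) =
      monomial (e s • Finsupp.single s p) 1 := fun s => by
    rw [SubmonoidClass.coe_pow]
    show monomial (Finsupp.single s p) (1 : k) ^ e s = _
    rw [monomial_pow, one_pow]
  simp_rw [hfac]
  rw [← monomial_sum_one, monomial_mul, one_mul]
  have hexp : p • vertexExp n p w v = Finsupp.single z p + ∑ s ∈ F, e s • Finsupp.single s p := by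
    ext i
    rw [Finsupp.smul_apply, Finsupp.add_apply, Finsupp.finsetSum_apply, Finsupp.single_apply,
      vertexExp_apply, smul_eq_mul]
    simp only [Finsupp.smul_apply, Finsupp.single_apply, smul_eq_mul]
    by_cases hi : w i = 1
    · have hiF : i ∈ F := Finset.mem_filter.mpr ⟨Finset.mem_univ _, hi⟩
      rw [Finset.sum_eq_single i (fun s _ hsi => by rw [if_neg hsi, mul_zero])
        (fun h => absurd hiF h), if_pos rfl]
      by_cases hiz : z = i
      · subst hiz
        rw [if_pos rfl, hez]
        have h1 : 1 ≤ (v.1 z : ℕ) := hvz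
        zify [h1]
        ring
      · rw [if_neg hiz, hes i (Ne.symm hiz), zero_add, mul_comm]
    · have hvi : (v.1 i : ℕ) = 0 := by rw [v.2.2 i hi]; rfl
      have hzi : z ≠ i := fun h => hi (h ▸ hz)
      rw [hvi, if_neg hzi, mul_zero, zero_add]
      refine (Finset.sum_eq_zero fun s hs => ?_).symm
      have hsi : s ≠ i := fun h => hi (h ▸ (Finset.mem_filter.mp hs).2)
      rw [if_neg hsi, mul_zero]
  rw [hexp]

/-- **`Bl_𝔪 (1/p)(1^a) × 𝔸^c` is regular** (Veronese type, all `p ≥ 2`): the pure-power charts are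
affine spaces and every other vertex chart `D₊(x^v t)` lies in `D₊(x_z^p t)` for any `z` with `v_z ≥ 1`.
[OURS · L1 W4.5c] — assembly modulo the two stubs above. -/
theorem isRegular_affineBlowup_veronese (hp : 1 < p) (hw : ∀ i, w i = 0 ∨ w i = 1) :
    Scheme.IsRegular (affineBlowup (vertexIdeal k n p w)) := by
  classical
  show Scheme.IsRegular (affineBlowup (Ideal.span (Set.range (vertexFamily k n p w))))
  refine JordanThree.isRegular_affineBlowup_of_charts (vertexFamily k n p w) fun i' => ?_
  obtain ⟨v, rfl⟩ := (Fintype.equivFin (VIdx n p w)).surjective i'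
  obtain ⟨z, hz, hvz⟩ := exists_pos_of_vIdx n p w (by omega) v
  obtain ⟨ρ, hρ⟩ := reesT_vertex_pow_eq k n p w (by omega) v z hz hvz
  exact ⟨Fintype.equivFin (VIdx n p w) (pureIdx n p w z hz),
    isRegularRing_chartRing_purePow k n p w hp hw z hz,
    basicOpen_le_of_pow_eq_mul _ _ _ ρ (by omega) hρ⟩

/-- The Veronese vertex ideal is non-zero as soon as some variable has weight `1`. [OURS · L1 W4.5c] -/
theorem vertexIdeal_ne_bot (h : ∃ i, w i = 1) : vertexIdeal k n p w ≠ ⊥ := by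
  classical
  obtain ⟨i, hi⟩ := h
  intro h0
  have key : vertexGen k n p w (pureIdx n p w i hi) = 0 :=
    (Ideal.span_eq_bot.mp h0) _ (by rw [range_vertexFamily]; exact ⟨_, rfl⟩)
  have := congrArg (fun x : cone k n p w => (x : MvPolynomial (Fin n) k)) key
  simp only [coe_vertexGen, ZeroMemClass.coe_zero, monomial_eq_zero] at this
  exact one_ne_zero this

/-- **S2-P2 Veronese brick, uniform in `p`.** For every field `k`, `n`, `p ≥ 2` and weight
`w : Fin n → ZMod p` with values in `{0,1}` and at least one weight-`1` variable, ONE blow-up — of the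
Veronese vertex ideal — resolves the cone `(1/p)(1^a) × 𝔸^c`: regular, integral, proper, birational.
[OURS · L1 W4.5c] — modulo the two stubs. -/
theorem blowup_regular_veronese (hp : 1 < p) (hw : ∀ i, w i = 0 ∨ w i = 1) (h : ∃ i, w i = 1) :
    Scheme.IsRegular (affineBlowup (vertexIdeal k n p w)) ∧
      IsIntegral (affineBlowup (vertexIdeal k n p w)) ∧
      IsProper (affineBlowup.π (vertexIdeal k n p w)) ∧
      IsBirational (affineBlowup.π (vertexIdeal k n p w)) := by
  have hne := vertexIdeal_ne_bot k n p w h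
  have hfg : (vertexIdeal k n p w).FG := Submodule.fg_span (Set.finite_range (vertexFamily k n p w))
  exact ⟨isRegular_affineBlowup_veronese k n p w hp hw, affineBlowup.isIntegral hne,
    affineBlowup.isProper_of_fg _ hfg, affineBlowup.isBirational hne⟩

end Summit.ResolutionOfSingularities.ResolutionOfSingularities.Theorems.WildQuotientResolution.PthCone

end
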